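import Summits.CriticalPhenomena.PercolationContinuityZ3.Theorems.Transplant.TransitiveClusterMoments
import Summits.CriticalPhenomena.PercolationContinuityZ3.Theorems.Transplant.TransitiveBoundaryFunctional
import Summits.CriticalPhenomena.PercolationContinuityZ3.Theorems.Transplant.DiagramRerootingMTP
import HarnessLib

/-!
# The fourth cluster moment against the two-point function on a vertex-transitive graph: `E[Σ_{a∈K}(Σ_{u∈K} τ(u,a))²] ≤ χ (B₀ + 2A₀)`

Proof file (`--supports stmt-CriticalPhenomena-4575 --as helper`), lane `prim-bschramm`, seat `prim-bschramm-gen-1` gen 13 (GEN pen); item (b2b) of the Q-DOOR-2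
port table (NOTES-g12-mirror §HANDOFF-QDOOR2; lead g29 RULING R-584-1 #10150, (α): ORIGINAL-form currency): the generic twin of «ClusterMomentBounds»
`tsum_measure_clusterIs_mul_sqSum_le` (Hutchcroft 2022, (2.4) second inequality) — **`Σ_S P_p(K_ρ = S) Σ_{a∈S}(Σ_{u∈S} τ(u,a))² ≤ χ · (B₀_p(ρ) + 2 A₀_p(ρ))`** in
`[0, ∞]`, for EVERY `p`, on any vertex-transitive graph with countably many vertices, with `χ = Σ'_z ofReal τ_p(ρ,z)` and the MIDPOINT-rooted diagrams
`diagA₀/diagB₀` of «DiagramRerootingMTP» (Hutchcroft §1.2 p. 5, original forms).  builds on p205010 (kernel theorem, internal audit signed; external expert review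
pending) — nothing here uses p205010.  Def-free; no instance, no notation, no sorry; nothing about `θ(p_c)`.

WHY THE ORIGINAL FORMS (R-584-1): after the four-point tree-graph bound, each pairing is `Σ_x τ(ρ,x) · D(x)` with `D(x)` a five-vertex diagram ROOTED AT `x`
— for the pairing `{ρ a | b c}` the `K_{2,3}` with `x` a MIDPOINT (= `diagB₀ G x p`), for `{ρ b | a c}` / `{ρ c | a b}` the θ-graph with `x` on the 3-path next to
a hub (= `diagA₀ G x p`); `D(x) = D(ρ)` by a ROOT-FIXED automorphism reindexing (`conn_iso`, transitivity only — `diagA₀_iso`, `diagB₀_iso`).  No mass transport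
here: the hub-rooted `diagA/diagB` of «DiagramComparisonAmenable» are reached downstream through the bridge `diagA₀_eq_diagA`/`diagB₀_eq_diagB` under
`IsGraphUnimodular` (discharged in item (d) from subexponential growth).

PORT DICTIONARY (as in (b2a) «TransitiveClusterMoments»): `tau d` ↦ `conn G`; `ofReal (chi d p)` ↦ `Σ'_z ofReal τ_p(ρ,z)`; the shift `· − x` ↦ the automorphism
`γ_x` with `γ_x ρ = x`; `diagBE`/`diagAE` ↦ `diagB₀ G ρ p` / `diagA₀ G ρ p`; `treeDiagram` is spelled out as its three products.
* §1 `summandA₀_iso`, `summandB₀_iso`, `diagA₀_iso`, `diagB₀_iso` (root transported with the variables);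
* §2 `sqSum_eq_sum`, `measure_openConn₄_le_tsum_conn` (the tree's generic four-point bound «TreeGraphBoundFour» `measure_openConn₄_le_tsum` written with `conn`);
* §3 the three pairings `tsum_pairing_one/two/three (htr)` (`= χ B₀`, `χ A₀`, `χ A₀`);
* §4 **`tsum_measure_clusterIs_mul_sqSum_le (htr) (p) (ρ)`**.
[cite: Hutchcroft2022Triangle, §2 ((2.4) second inequality, (2.7) and the last display of the proof of Prop. 1.6)] [cite: AizenmanNewman1984, §4 (Prop. 4.1, tree-graph inequalities)]
-/

noncomputable section

namespace Summit.CriticalPhenomena.PercolationContinuityZ3.Theorems.Transplant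

namespace Grigorchuk

namespace NcHaraSlade

open SimpleGraph Finset MeasureTheory Filter Topology Literature.Probability.Percolation Literature.Barriers.CriticalPhenomena
open scoped ENNReal

variable {V : Type} [DecidableEq V] (G : SimpleGraph V) [G.LocallyFinite]

/-! ## §1 Automorphism invariance of the original-form diagrams (root transported) -/

omit [DecidableEq V] [G.LocallyFinite] in
/-- `summandA₀` is `Aut(G)`-invariant. [folklore] -/
theorem summandA₀_iso (γ : G ≃g G) (p : unitInterval) (o : V) (q : V × V × V × V) :
    summandA₀ G p (γ o) (γ q.1, γ q.2.1, γ q.2.2.1, γ q.2.2.2) = summandA₀ G p o q := by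
  simp only [summandA₀, conn_iso]

omit [DecidableEq V] [G.LocallyFinite] in
/-- `summandB₀` is `Aut(G)`-invariant. [folklore] -/
theorem summandB₀_iso (γ : G ≃g G) (p : unitInterval) (o : V) (q : V × V × V × V) :
    summandB₀ G p (γ o) (γ q.1, γ q.2.1, γ q.2.2.1, γ q.2.2.2) = summandB₀ G p o q := by
  simp only [summandB₀, conn_iso]

omit [DecidableEq V] [G.LocallyFinite] in
/-- **`A₀_p(γ o) = A₀_p(o)`** (root-fixed transport: transitivity alone identifies the midpoint-rooted diagram at all roots). [folklore] -/
theorem diagA₀_iso (γ : G ≃g G) (o : V) (p : unitInterval) : diagA₀ G (γ o) p = diagA₀ G o p := by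
  unfold diagA₀
  set e : V × V × V × V ≃ V × V × V × V := Equiv.prodCongr γ.toEquiv (Equiv.prodCongr γ.toEquiv (Equiv.prodCongr γ.toEquiv γ.toEquiv)) with he
  rw [← e.tsum_eq]
  refine tsum_congr fun q => ?_
  have hq : e q = (γ q.1, γ q.2.1, γ q.2.2.1, γ q.2.2.2) := by simp only [he, Equiv.prodCongr_apply, Prod.map, RelIso.coe_fn_toEquiv]
  rw [hq, summandA₀_iso]

omit [DecidableEq V] [G.LocallyFinite] in
/-- **`B₀_p(γ o) = B₀_p(o)`**. [folklore] -/
theorem diagB₀_iso (γ : G ≃g G) (o : V) (p : unitInterval) : diagB₀ G (γ o) p = diagB₀ G o p := by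
  unfold diagB₀
  set e : V × V × V × V ≃ V × V × V × V := Equiv.prodCongr γ.toEquiv (Equiv.prodCongr γ.toEquiv (Equiv.prodCongr γ.toEquiv γ.toEquiv)) with he
  rw [← e.tsum_eq]
  refine tsum_congr fun q => ?_
  have hq : e q = (γ q.1, γ q.2.1, γ q.2.2.1, γ q.2.2.2) := by simp only [he, Equiv.prodCongr_apply, Prod.map, RelIso.coe_fn_toEquiv]
  rw [hq, summandB₀_iso]

/-! ## §2 `sqSum` as a triple sum; the four-point tree-graph bound with `conn` -/

omit [DecidableEq V] [G.LocallyFinite] in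
/-- `Σ_{a∈S}(Σ_{u∈S} τ(u,a))² = Σ_{a,b,c ∈ S} τ(b,a) τ(c,a)`. [folklore] -/
theorem sqSum_eq_sum (p : unitInterval) (S : Finset V) :
    sqSum G p S = ∑ a ∈ S, ∑ b ∈ S, ∑ c ∈ S, conn G p b a * conn G p c a := by
  rw [sqSum]
  refine Finset.sum_congr rfl fun a _ => ?_
  rw [connRow, sq, Finset.sum_mul_sum]

omit [DecidableEq V] [G.LocallyFinite] in
/-- **Four-point tree-graph bound with the two-point function** on a graph with countably many vertices: `P_p(x₁, x₂, y₁, y₂ in one open cluster) ≤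
Σ_{u,v} [τ(x₁,u)τ(x₂,u)τ(u,v)τ(v,y₁)τ(v,y₂) + τ(x₁,u)τ(y₁,u)τ(u,v)τ(v,x₂)τ(v,y₂) + τ(x₁,u)τ(y₂,u)τ(u,v)τ(v,x₂)τ(v,y₁)]` in `[0, ∞]` (the tree's
«TreeGraphBoundFour» `measure_openConn₄_le_tsum` + the BK bound `measure_treeEvent_le_ofReal`, `τ = conn` by `rfl`). [cite: AizenmanNewman1984, §4 (Prop. 4.1)] -/
theorem measure_openConn₄_le_tsum_conn [Countable V] (p : unitInterval) (x₁ x₂ y₁ y₂ : V) :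
    bondPercolation G p (openConn₄ x₁ x₂ y₁ y₂) ≤
      ∑' uv : V × V, (ENNReal.ofReal (conn G p x₁ uv.1 * (conn G p x₂ uv.1 * (conn G p uv.1 uv.2 * (conn G p uv.2 y₁ * conn G p uv.2 y₂)))) +
        ENNReal.ofReal (conn G p x₁ uv.1 * (conn G p y₁ uv.1 * (conn G p uv.1 uv.2 * (conn G p uv.2 x₂ * conn G p uv.2 y₂)))) +
          ENNReal.ofReal (conn G p x₁ uv.1 * (conn G p y₂ uv.1 * (conn G p uv.1 uv.2 * (conn G p uv.2 x₂ * conn G p uv.2 y₁))))) := by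
  refine (measure_openConn₄_le_tsum G p x₁ x₂ y₁ y₂).trans (ENNReal.tsum_le_tsum fun uv => ?_)
  exact add_le_add (add_le_add (measure_treeEvent_le_ofReal G p _ _ _ _ _ _) (measure_treeEvent_le_ofReal G p _ _ _ _ _ _))
    (measure_treeEvent_le_ofReal G p _ _ _ _ _ _)

/-! ## §3 The three pairings -/

omit [DecidableEq V] [G.LocallyFinite] in
/-- First pairing `{ρ a | b c}`: `Σ_{a,b,c,x,y} τ(b,a)τ(c,a)·τ(ρ,x)τ(a,x)τ(x,y)τ(y,b)τ(y,c) = χ · B₀_p(ρ)` on a vertex-transitive graph — reorder to `Σ_x τ(ρ,x) · [K_{2,3}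
rooted at the midpoint x]`, `= Σ_x τ(ρ,x) B₀(x)` with `q = (a, y, b, c)` in `summandB₀`, and `B₀(x) = B₀(ρ)` by `diagB₀_iso`.
[cite: Hutchcroft2022Triangle, §2 (proof of Prop. 1.6, last display: "= χ_β(2A_β + B_β)")] -/
theorem tsum_pairing_one (htr : IsGraphTransitive G) (p : unitInterval) (ρ : V) :
    ∑' w : (V × V × V) × (V × V),
      ENNReal.ofReal (conn G p w.1.2.1 w.1.1 * conn G p w.1.2.2 w.1.1 *
        (conn G p ρ w.2.1 * (conn G p w.1.1 w.2.1 * (conn G p w.2.1 w.2.2 * (conn G p w.2.2 w.1.2.1 * conn G p w.2.2 w.1.2.2))))) =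
      (∑' z : V, ENNReal.ofReal (conn G p ρ z)) * diagB₀ G ρ p := by
  -- reorder to `Σ_x Σ_{q = (a, y, b, c)}`
  let e : (V × V × V) × (V × V) ≃ V × (V × V × V × V) :=
    { toFun := fun w => (w.2.1, (w.1.1, w.2.2, w.1.2.1, w.1.2.2))
      invFun := fun z => ((z.2.1, z.2.2.2.1, z.2.2.2.2), (z.1, z.2.2.1))
      left_inv := fun _ => rfl
      right_inv := fun _ => rfl }
  rw [← e.symm.tsum_eq]
  simp only [e, Equiv.coe_fn_symm_mk]
  rw [ENNReal.tsum_prod', ← ENNReal.tsum_mul_right]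
  refine tsum_congr fun x => ?_
  obtain ⟨γ, hγ⟩ := htr ρ x
  rw [← diagB₀_iso G γ ρ p, hγ, diagB₀, ← ENNReal.tsum_mul_left]
  refine tsum_congr fun q => ?_
  rw [← ENNReal.ofReal_mul (conn_nonneg G p _ _), summandB₀]
  congr 1
  rw [conn_comm G p q.2.2.1 q.1, conn_comm G p q.2.2.2 q.1, conn_comm G p q.1 x]
  ring

omit [DecidableEq V] [G.LocallyFinite] in
/-- Second pairing `{ρ b | a c}`: `Σ τ(b,a)τ(c,a)·τ(ρ,x)τ(b,x)τ(x,y)τ(y,a)τ(y,c) = χ · A₀_p(ρ)` — reorder to `Σ_x τ(ρ,x) · [θ-graph with hubs y, a and x on the 3-path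
next to y]`, `= Σ_x τ(ρ,x) A₀(x)` with `q = (y, b, a, c)` in `summandA₀`, and `A₀(x) = A₀(ρ)` by `diagA₀_iso`. [cite: Hutchcroft2022Triangle, §2 (proof of Prop. 1.6, last display)] -/
theorem tsum_pairing_two (htr : IsGraphTransitive G) (p : unitInterval) (ρ : V) :
    ∑' w : (V × V × V) × (V × V),
      ENNReal.ofReal (conn G p w.1.2.1 w.1.1 * conn G p w.1.2.2 w.1.1 *
        (conn G p ρ w.2.1 * (conn G p w.1.2.1 w.2.1 * (conn G p w.2.1 w.2.2 * (conn G p w.2.2 w.1.1 * conn G p w.2.2 w.1.2.2))))) =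
      (∑' z : V, ENNReal.ofReal (conn G p ρ z)) * diagA₀ G ρ p := by
  -- reorder to `Σ_x Σ_{q = (y, b, a, c)}`
  let e : (V × V × V) × (V × V) ≃ V × (V × V × V × V) :=
    { toFun := fun w => (w.2.1, (w.2.2, w.1.2.1, w.1.1, w.1.2.2))
      invFun := fun z => ((z.2.2.2.1, z.2.2.1, z.2.2.2.2), (z.1, z.2.1))
      left_inv := fun _ => rfl
      right_inv := fun _ => rfl }
  rw [← e.symm.tsum_eq]
  simp only [e, Equiv.coe_fn_symm_mk]
  rw [ENNReal.tsum_prod', ← ENNReal.tsum_mul_right]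
  refine tsum_congr fun x => ?_
  obtain ⟨γ, hγ⟩ := htr ρ x
  rw [← diagA₀_iso G γ ρ p, hγ, diagA₀, ← ENNReal.tsum_mul_left]
  refine tsum_congr fun q => ?_
  rw [← ENNReal.ofReal_mul (conn_nonneg G p _ _), summandA₀]
  congr 1
  rw [conn_comm G p q.2.1 x]
  ring

omit [DecidableEq V] [G.LocallyFinite] in
/-- Third pairing `{ρ c | a b}`: `Σ τ(b,a)τ(c,a)·τ(ρ,x)τ(c,x)τ(x,y)τ(y,a)τ(y,b) = χ · A₀_p(ρ)` (swap `b ↔ c` in the second pairing).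
[cite: Hutchcroft2022Triangle, §2 (proof of Prop. 1.6, last display)] -/
theorem tsum_pairing_three (htr : IsGraphTransitive G) (p : unitInterval) (ρ : V) :
    ∑' w : (V × V × V) × (V × V),
      ENNReal.ofReal (conn G p w.1.2.1 w.1.1 * conn G p w.1.2.2 w.1.1 *
        (conn G p ρ w.2.1 * (conn G p w.1.2.2 w.2.1 * (conn G p w.2.1 w.2.2 * (conn G p w.2.2 w.1.1 * conn G p w.2.2 w.1.2.1))))) =
      (∑' z : V, ENNReal.ofReal (conn G p ρ z)) * diagA₀ G ρ p := by
  rw [← tsum_pairing_two G htr p ρ]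
  -- swap `b ↔ c`
  let e : (V × V × V) × (V × V) ≃ (V × V × V) × (V × V) :=
    { toFun := fun w => ((w.1.1, w.1.2.2, w.1.2.1), w.2)
      invFun := fun w => ((w.1.1, w.1.2.2, w.1.2.1), w.2)
      left_inv := fun _ => rfl
      right_inv := fun _ => rfl }
  rw [← e.tsum_eq]
  refine tsum_congr fun w => ?_
  simp only [e, Equiv.coe_fn_mk]
  congr 1
  ring

/-! ## §4 Hutchcroft (2.4), second inequality -/

omit [G.LocallyFinite] in
/-- **Hutchcroft (2.4), second inequality, on a vertex-transitive graph** (every `p`; countably many vertices):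
`Σ_S P_p(K_ρ = S) Σ_{a∈S}(Σ_{u∈S} τ_p(u,a))² ≤ χ · (B₀_p(ρ) + 2 A₀_p(ρ))` in `[0, ∞]`, with `χ = Σ'_z ofReal τ_p(ρ,z)` and the midpoint-rooted diagrams `diagB₀`,
`diagA₀` of «DiagramRerootingMTP».  Proof: `Σ_S P(K=S)𝟙{a,b,c∈S} ≤ P(ρ,a,b,c in one cluster) ≤` the four-point tree-graph bound (three pairings), and the pairings are
`χB₀`, `χA₀`, `χA₀` by root-fixed transport. [cite: Hutchcroft2022Triangle, §2 ((2.4) second inequality, (2.7) and the last display of the proof of Prop. 1.6)] -/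
theorem tsum_measure_clusterIs_mul_sqSum_le [Countable V] (htr : IsGraphTransitive G) (p : unitInterval) (ρ : V) :
    ∑' S : Finset V, bondPercolation G p (clusterIs ρ S) * ENNReal.ofReal (sqSum G p S) ≤
      (∑' z : V, ENNReal.ofReal (conn G p ρ z)) * (diagB₀ G ρ p + 2 * diagA₀ G ρ p) := by
  classical
  set μ := bondPercolation G p with hμ
  have h0 : ∀ a b c : V, 0 ≤ conn G p b a * conn G p c a := fun a b c => mul_nonneg (conn_nonneg G p b a) (conn_nonneg G p c a)
  have h5 : ∀ a₁ b₁ a₂ b₂ a₃ b₃ a₄ b₄ a₅ b₅ : V,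
      0 ≤ conn G p a₁ b₁ * (conn G p a₂ b₂ * (conn G p a₃ b₃ * (conn G p a₄ b₄ * conn G p a₅ b₅))) := fun _ _ _ _ _ _ _ _ _ _ =>
    mul_nonneg (conn_nonneg G p _ _) (mul_nonneg (conn_nonneg G p _ _) (mul_nonneg (conn_nonneg G p _ _)
      (mul_nonneg (conn_nonneg G p _ _) (conn_nonneg G p _ _))))
  -- Step 1: expand as indicators over triples and exchange
  have h1 : ∀ S : Finset V, μ (clusterIs ρ S) * ENNReal.ofReal (sqSum G p S) =
      ∑' t : V × V × V, (if t.1 ∈ S ∧ t.2.1 ∈ S ∧ t.2.2 ∈ S then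
        ENNReal.ofReal (conn G p t.2.1 t.1 * conn G p t.2.2 t.1) * μ (clusterIs ρ S) else 0) := by
    intro S
    rw [sqSum_eq_sum, ENNReal.ofReal_sum_of_nonneg (fun a _ => Finset.sum_nonneg fun b _ =>
      Finset.sum_nonneg fun c _ => h0 a b c)]
    simp_rw [ENNReal.ofReal_sum_of_nonneg (fun b _ => Finset.sum_nonneg fun c _ => h0 _ b c),
      ENNReal.ofReal_sum_of_nonneg (fun c _ => h0 _ _ c)]
    rw [Finset.mul_sum]
    simp_rw [Finset.mul_sum]
    rw [tsum_eq_sum (s := S ×ˢ (S ×ˢ S)) (fun t ht => if_neg (by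
      simp only [Finset.mem_product] at ht; tauto))]
    rw [Finset.sum_product, Finset.sum_congr rfl (fun a _ => Finset.sum_product _ _ _)]
    refine Finset.sum_congr rfl fun a ha => Finset.sum_congr rfl fun b hb => Finset.sum_congr rfl fun c hc => ?_
    rw [if_pos ⟨ha, hb, hc⟩, mul_comm]
  simp_rw [h1]
  rw [ENNReal.tsum_comm]
  -- Step 2: bound the inner sum by the four-point function and the tree-graph bound
  have h2 : ∀ t : V × V × V, ∑' S : Finset V, (if t.1 ∈ S ∧ t.2.1 ∈ S ∧ t.2.2 ∈ S then
      ENNReal.ofReal (conn G p t.2.1 t.1 * conn G p t.2.2 t.1) * μ (clusterIs ρ S) else 0) ≤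
      ENNReal.ofReal (conn G p t.2.1 t.1 * conn G p t.2.2 t.1) *
        ∑' xy : V × V, (ENNReal.ofReal (conn G p ρ xy.1 * (conn G p t.1 xy.1 * (conn G p xy.1 xy.2 * (conn G p xy.2 t.2.1 * conn G p xy.2 t.2.2)))) +
          ENNReal.ofReal (conn G p ρ xy.1 * (conn G p t.2.1 xy.1 * (conn G p xy.1 xy.2 * (conn G p xy.2 t.1 * conn G p xy.2 t.2.2)))) +
            ENNReal.ofReal (conn G p ρ xy.1 * (conn G p t.2.2 xy.1 * (conn G p xy.1 xy.2 * (conn G p xy.2 t.1 * conn G p xy.2 t.2.1))))) := by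
    intro t
    have h : ∑' S : Finset V, (if t.1 ∈ S ∧ t.2.1 ∈ S ∧ t.2.2 ∈ S then
        ENNReal.ofReal (conn G p t.2.1 t.1 * conn G p t.2.2 t.1) * μ (clusterIs ρ S) else 0) =
        ENNReal.ofReal (conn G p t.2.1 t.1 * conn G p t.2.2 t.1) *
          ∑' S : Finset V, (if t.1 ∈ S ∧ t.2.1 ∈ S ∧ t.2.2 ∈ S then μ (clusterIs ρ S) else 0) := by
      rw [← ENNReal.tsum_mul_left]
      refine tsum_congr fun S => ?_
      split_ifs <;> simp
    rw [h]
    refine mul_le_mul_of_nonneg_left ((tsum_ite_measure_clusterIs_le G p ρ _ (openConn₄ ρ t.1 t.2.1 t.2.2)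
      (fun S hS => ?_)).trans (measure_openConn₄_le_tsum_conn G p ρ t.1 t.2.1 t.2.2)) (zero_le)
    intro ω hω
    exact ⟨⟨clusterIs_subset_openConn hS.1 hω, clusterIs_subset_openConn hS.2.1 hω⟩,
      clusterIs_subset_openConn hS.2.2 hω⟩
  refine (ENNReal.tsum_le_tsum h2).trans (le_of_eq ?_)
  -- Step 3: split the three pairings and identify them
  simp_rw [← ENNReal.tsum_mul_left]
  rw [← ENNReal.tsum_prod]
  have hsplit : ∀ w : (V × V × V) × (V × V),
      ENNReal.ofReal (conn G p w.1.2.1 w.1.1 * conn G p w.1.2.2 w.1.1) *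
        (ENNReal.ofReal (conn G p ρ w.2.1 * (conn G p w.1.1 w.2.1 * (conn G p w.2.1 w.2.2 * (conn G p w.2.2 w.1.2.1 * conn G p w.2.2 w.1.2.2)))) +
          ENNReal.ofReal (conn G p ρ w.2.1 * (conn G p w.1.2.1 w.2.1 * (conn G p w.2.1 w.2.2 * (conn G p w.2.2 w.1.1 * conn G p w.2.2 w.1.2.2)))) +
            ENNReal.ofReal (conn G p ρ w.2.1 * (conn G p w.1.2.2 w.2.1 * (conn G p w.2.1 w.2.2 * (conn G p w.2.2 w.1.1 * conn G p w.2.2 w.1.2.1))))) =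
      ENNReal.ofReal (conn G p w.1.2.1 w.1.1 * conn G p w.1.2.2 w.1.1 *
        (conn G p ρ w.2.1 * (conn G p w.1.1 w.2.1 * (conn G p w.2.1 w.2.2 * (conn G p w.2.2 w.1.2.1 * conn G p w.2.2 w.1.2.2))))) +
      ENNReal.ofReal (conn G p w.1.2.1 w.1.1 * conn G p w.1.2.2 w.1.1 *
        (conn G p ρ w.2.1 * (conn G p w.1.2.1 w.2.1 * (conn G p w.2.1 w.2.2 * (conn G p w.2.2 w.1.1 * conn G p w.2.2 w.1.2.2))))) +
      ENNReal.ofReal (conn G p w.1.2.1 w.1.1 * conn G p w.1.2.2 w.1.1 *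
        (conn G p ρ w.2.1 * (conn G p w.1.2.2 w.2.1 * (conn G p w.2.1 w.2.2 * (conn G p w.2.2 w.1.1 * conn G p w.2.2 w.1.2.1))))) := by
    intro w
    have hw : 0 ≤ conn G p w.1.2.1 w.1.1 * conn G p w.1.2.2 w.1.1 := h0 _ _ _
    rw [mul_add, mul_add, ← ENNReal.ofReal_mul hw, ← ENNReal.ofReal_mul hw, ← ENNReal.ofReal_mul hw]
  simp_rw [hsplit]
  rw [ENNReal.tsum_add, ENNReal.tsum_add, tsum_pairing_one G htr p ρ, tsum_pairing_two G htr p ρ, tsum_pairing_three G htr p ρ]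
  ring

end NcHaraSlade

end Grigorchuk

end Summit.CriticalPhenomena.PercolationContinuityZ3.Theorems.Transplant

end
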